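import Mathlib
import Summits.Langlands.Langlands.Theorems.CapacityClassicalityHilbertIntegralOverconvergentIsCongruenceAlgebraicHalf

/-!
# Crux `HilbertIntegralOverconvergentIsCongruence` (stmt-Langlands-8485), line `Sketch-ideate-r1-k1`:
# the graded gain for a `𝓦`-graded family (stub S3, `stub_gradedKatzGainW`)

The graded Katz gain of `…GradedKatzGain.lean` / `…AlgebraicHalf.lean` (`stub_gradedKatzGain`,
`stub_gradedKatzGainFree`) with the grading group `ℤ` replaced by an arbitrary additive commutative
group `𝓦` of weights and `i * t` replaced by the `ℕ`-scalar multiple `i • t`: for a graded family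
`V : 𝓦 → Set (MvPowerSeries σ K)` (`1 ∈ V 0`, `V a · V b ⊆ V (a+b)`, each `V a` closed under finite
sums) with the sup-norm Sturm principle on windows `W b` strictly below a Sturm line `L b` for a
monotone weight `wt`, an integral Hasse lift `e ∈ V t` with constant term `1` and a Katz datum
`a_i ∈ V (w + i • t)`, `‖(a_i)_n‖ ≤ C ρ^i`, summing to `G` along `e⁻¹`, vanishing of `G` in weights
`< m` together with `L (w + M • t) ≤ m` gives `‖G_n‖ ≤ C ρ^{M+1}` for every exponent `n`.  The
truncation `Σ_{i ≤ M} a_i e^{M-i}` lies in `V (w + M • t)` by the grading, `{wt < m}` is a lower set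
containing `W (w + M • t)`, and the ungraded lever `stub_katzSturmLever` (LANDED in
`…AlgebraicHalf.lean`, imported) finishes.  Theorems only, no `sorry`.
-/

set_option linter.dupNamespace false

noncomputable section

namespace Summit.Langlands.Langlands.Theorems.HilbertIntegralOverconvergentIsCongruence

open MvPowerSeries in
/-- **stub S3 — `stub_gradedKatzGainW` (S; 18′ for a `𝓦`-graded family).**  Over a nonarchimedean normed
field `K` in variables `σ`, weights in an additive commutative group `𝓦`: for a graded family `V : 𝓦 → Set`
(`1 ∈ V 0`, `V a · V b ⊆ V (a+b)`, each `V a` closed under finite sums) with the sup-norm Sturm principle on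
windows `W b` strictly below a Sturm line `L b` for a monotone weight `wt`, an integral Hasse lift `e ∈ V t`
with constant term `1`, and a Katz datum `a_i ∈ V (w + i • t)`, `‖(a_i)_n‖ ≤ C ρ^i`, summing to `G`
along `e⁻¹`: if `G_n = 0` whenever `wt n < m` and `L (w + M • t) ≤ m`, then `‖G_n‖ ≤ C ρ^{M+1}` for every
`n` (port of `…GradedKatzGain.lean` with `ℤ` replaced by `𝓦`; the ungraded lever `stub_katzSturmLever` of
`…AlgebraicHalf.lean` is imported, not re-proved). [folklore] -/
theorem stub_gradedKatzGainW {K σ 𝓦 : Type*} [NormedField K] [IsUltrametricDist K] [AddCommGroup 𝓦]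
    (V : 𝓦 → Set (MvPowerSeries σ K)) (hV1 : (1 : MvPowerSeries σ K) ∈ V 0)
    (hVmul : ∀ (b₁ b₂ : 𝓦) (φ ψ : MvPowerSeries σ K), φ ∈ V b₁ → ψ ∈ V b₂ → φ * ψ ∈ V (b₁ + b₂))
    (hVsum : ∀ (b : 𝓦) (s : Finset ℕ) (φ : ℕ → MvPowerSeries σ K),
      (∀ i ∈ s, φ i ∈ V b) → (∑ i ∈ s, φ i) ∈ V b)
    (W : 𝓦 → Set (σ →₀ ℕ))
    (hSturm : ∀ (b : 𝓦), ∀ T ∈ V b, ∀ B : ℝ, 0 ≤ B → (∀ n ∈ W b, ‖coeff n T‖ ≤ B) →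
      ∀ n, ‖coeff n T‖ ≤ B)
    (wt : (σ →₀ ℕ) → ℕ) (hwt : Monotone wt) (L : 𝓦 → ℕ) (hWL : ∀ b, ∀ n ∈ W b, wt n < L b)
    (e : MvPowerSeries σ K) (t : 𝓦) (he0 : constantCoeff e = 1) (he : ∀ n, ‖coeff n e‖ ≤ 1)
    (heV : e ∈ V t)
    (a : ℕ → MvPowerSeries σ K) (w : 𝓦) (haV : ∀ i : ℕ, a i ∈ V (w + i • t))
    (ρ C : ℝ) (hρ : 0 ≤ ρ) (hρ1 : ρ ≤ 1) (hC : 0 ≤ C) (ha : ∀ i n, ‖coeff n (a i)‖ ≤ C * ρ ^ i)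
    (G : MvPowerSeries σ K) (hG : ∀ n, HasSum (fun i : ℕ ↦ coeff n (a i * e⁻¹ ^ i)) (coeff n G))
    (m : ℕ) (hvan : ∀ n, wt n < m → coeff n G = 0) (M : ℕ) (hM : L (w + M • t) ≤ m) :
    ∀ n, ‖coeff n G‖ ≤ C * ρ ^ (M + 1) := by
  -- powers of the Hasse lift are graded: `e^k ∈ V (k • t)`
  have hepow : ∀ k : ℕ, e ^ k ∈ V (k • t) := by
    intro k
    induction k with
    | zero => simpa using hV1
    | succ k ih =>
        have := hVmul _ _ _ _ ih heV
        rw [← pow_succ] at this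
        rwa [succ_nsmul]
  -- the truncation is classical of weight `w + M • t`
  have htrunc : (∑ i ∈ Finset.range (M + 1), a i * e ^ (M - i)) ∈ V (w + M • t) := by
    refine hVsum _ _ _ fun i hi ↦ ?_
    have hiM : i ≤ M := Nat.lt_succ_iff.mp (Finset.mem_range.mp hi)
    have := hVmul _ _ _ _ (haV i) (hepow (M - i))
    rwa [add_assoc, ← add_nsmul, Nat.add_sub_cancel' hiM] at this
  -- `{wt < m}` is a lower set containing the window of weight `w + M • t`
  have hlower : IsLowerSet {n : σ →₀ ℕ | wt n < m} := fun n n' hle hn ↦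
    lt_of_le_of_lt (hwt hle) hn
  have hWD : W (w + M • t) ⊆ {n : σ →₀ ℕ | wt n < m} := fun n hn ↦
    lt_of_lt_of_le (hWL _ n hn) hM
  exact stub_katzSturmLever (V (w + M • t)) (W (w + M • t)) (hSturm _) e he0 he a ρ C hρ hρ1 hC ha M
    htrunc G hG {n | wt n < m} hlower (fun n hn ↦ hvan n hn) hWD

end Summit.Langlands.Langlands.Theorems.HilbertIntegralOverconvergentIsCongruence

end
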